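import Summits.HodgeConjecture.HodgeConjecture.Theorems.NoetherLefschetzOneUpLevelZeroNetsAlgebra
import Literature.AlgebraicGeometry.Morphisms.ZariskiConnectednessProper
import Literature.AlgebraicGeometry.Morphisms.SteinFactorizationProofs
import Literature.AlgebraicGeometry.Morphisms.SteinFactorizationConnectedFibres

/-!
# Route NoetherLefschetzOneUp — `LevelZeroNets` (stmt-HodgeConjecture-11602), II:
# connected general fibre ⇒ all fibres geometrically connected

Scheme-theoretic half of the bridge between the item `LevelZeroNets` and the named fact
`Literature.AlgebraicGeometry.HodgeTheory.Arapura2022_hodgeConjecture_pgZeroSurfaceFibration`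
(Arapura 2022, Cor. 1.5, whose standing hypothesis is "connected fibres"), see the module docstring
of `NoetherLefschetzOneUpLevelZeroNetsAlgebra`. Everything here is PROVED (no named fact is taken):

* `finite_app` — for `f : X → S` proper and `S` locally Noetherian, `𝒪_S(U) → 𝒪_X(f⁻¹U)` is finite
  on affine opens (the tree's finiteness theorem for `H⁰`,
  `Literature.AlgebraicGeometry.Morphisms.finite_algebraMapΓ_of_isProper`, EGA III₁ 3.2.1).
* `maximal_over_unique` — if the fibre of `f` over the closed point `s ∈ U` is preconnected, at most
  one maximal ideal of `𝒪_X(f⁻¹U)` lies over the maximal ideal of `s` (the canonical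
  `f⁻¹U → Spec 𝒪_X(f⁻¹U)` is surjective and the maximal ideals over `s` are finitely many closed
  points partitioning the fibre).
* `bijective_app_of_isPreconnected_fibres` — `𝒪_S = f_* 𝒪_X` on affine opens for `f` proper
  surjective, `X` integral, `S` integral normal locally of finite type over an algebraically closed
  field of characteristic zero, fibres over the closed points off a proper closed `T` preconnected
  (the algebraic core `surjective_algebraMap_of_subsingleton_maximal_over`).
* `isIso_fromNormalization_of_isPreconnected_fibres`,
  `geometricallyConnected_of_isPreconnected_fibres` — hence the Stein factorisation of `f` is
  trivial and, by the tree's PROVED Stein factorisation theorem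
  `Literature.AlgebraicGeometry.Morphisms.steinFactorization_geometricallyConnected_holds`
  (Stacks 03H2), ALL fibres of `f` are geometrically connected (Zariski's connectedness theorem in
  the form: normal base, connected general fibre, characteristic zero).
-/

set_option linter.dupNamespace false

noncomputable section

namespace Summit.HodgeConjecture.HodgeConjecture.Theorems

namespace LevelZeroNetsStein

open CategoryTheory AlgebraicGeometry TopologicalSpace Opposite

universe u

/-- **Finiteness of `f_* 𝒪_X` on an affine open** for `f : X → S` proper and `S` locally
Noetherian: `𝒪_S(U) → 𝒪_X(f⁻¹U)` is a finite ring map (the finiteness theorem for `H⁰`,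
`Literature.AlgebraicGeometry.Morphisms.finite_algebraMapΓ_of_isProper`, applied to the proper
`U`-scheme `f⁻¹U → U ≅ Spec 𝒪_S(U)`). -/
theorem finite_app {X S : Scheme.{u}} (f : X ⟶ S) [IsProper f] [IsLocallyNoetherian S]
    (U : S.Opens) (hU : IsAffineOpen U) : (f.app U).hom.Finite := by
  haveI : IsNoetherianRing Γ(S, U) := IsLocallyNoetherian.component_noetherian ⟨U, hU⟩
  haveI : IsAffine U := hU
  haveI : IsProper (f.resLE U (f ⁻¹ᵁ U) le_rfl) := by
    rw [Scheme.Hom.resLE_eq_morphismRestrict]; infer_instance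
  haveI : IsIso U.toSpecΓ := inferInstanceAs (IsIso hU.isoSpec.hom)
  set g : (↑(f ⁻¹ᵁ U) : Scheme.{u}) ⟶ Spec Γ(S, U) := f.resLE U (f ⁻¹ᵁ U) le_rfl ≫ U.toSpecΓ
    with hg
  have h := Literature.AlgebraicGeometry.Morphisms.finite_algebraMapΓ_of_isProper g
  have e : g.appTop = (Scheme.ΓSpecIso Γ(S, U)).hom ≫ f.app U ≫ (f ⁻¹ᵁ U).topIso.inv := by
    rw [hg, Scheme.Hom.comp_appTop, Scheme.Opens.toSpecΓ_appTop, Scheme.Hom.appTop,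
      Scheme.Hom.resLE_app_top, ← Scheme.Hom.app_eq_appLE]
    simp only [Category.assoc, Iso.inv_hom_id_assoc]
  have e' : Literature.AlgebraicGeometry.Morphisms.algebraMapΓ g =
      (f ⁻¹ᵁ U).topIso.inv.hom.comp (f.app U).hom := by
    unfold Literature.AlgebraicGeometry.Morphisms.algebraMapΓ
    rw [e]
    ext a
    simp only [CommRingCat.hom_comp, RingHom.coe_comp, Function.comp_apply]
    erw [Iso.inv_hom_id_apply]
  rw [e'] at h
  have h2 : ((f ⁻¹ᵁ U).topIso.hom.hom.comp ((f ⁻¹ᵁ U).topIso.inv.hom.comp (f.app U).hom)).Finite :=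
    RingHom.Finite.comp (RingHom.Finite.of_surjective _
      (ConcreteCategory.bijective_of_isIso (f ⁻¹ᵁ U).topIso.hom).2) h
  have e3 : (f ⁻¹ᵁ U).topIso.hom.hom.comp ((f ⁻¹ᵁ U).topIso.inv.hom.comp (f.app U).hom) =
      (f.app U).hom := by
    rw [← RingHom.comp_assoc, ← CommRingCat.hom_comp, Iso.inv_hom_id, CommRingCat.hom_id,
      RingHom.id_comp]
  rwa [e3] at h2

/-- **One maximal ideal above a closed point with connected fibre.** Let `f : X → S` be proper,
`U ⊆ S` affine open with `A = 𝒪_S(U) → B = 𝒪_X(f⁻¹U)` finite, `m ⊂ A` a maximal ideal with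
corresponding point `s ∈ U`, and suppose the fibre `f⁻¹(s)` is preconnected. Then any two maximal
ideals of `B` lying over `m` coincide: the canonical map `g : f⁻¹U → Spec B` is surjective (dominant
and universally closed) and compatible with `f`, the maximal ideals of `B` over `m` are finitely
many closed points, and their preimages under `g` partition the preconnected `f⁻¹(s)` into
non-empty disjoint closed pieces. -/
theorem maximal_over_unique {X S : Scheme.{u}} (f : X ⟶ S) [IsProper f]
    (U : S.Opens) (hU : IsAffineOpen U) (hfin : (f.app U).hom.Finite)
    (m : Ideal Γ(S, U)) [hm : m.IsMaximal]
    (hconn : _root_.IsPreconnected (f ⁻¹' {hU.fromSpec ⟨m, hm.isPrime⟩}))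
    (Q₁ Q₂ : Ideal Γ(X, f ⁻¹ᵁ U)) [hQ₁ : Q₁.IsMaximal] [hQ₂ : Q₂.IsMaximal]
    (h₁ : Q₁.comap (f.app U).hom = m) (h₂ : Q₂.comap (f.app U).hom = m) : Q₁ = Q₂ := by
  classical
  haveI : IsAffine U := hU
  -- the canonical map `g : f⁻¹U → Spec B` and `π : Spec B → Spec A`
  set g : (↑(f ⁻¹ᵁ U) : Scheme.{u}) ⟶ Spec Γ(X, f ⁻¹ᵁ U) := (f ⁻¹ᵁ U).toSpecΓ with hg
  set π : Spec Γ(X, f ⁻¹ᵁ U) ⟶ Spec Γ(S, U) := Spec.map (f.app U) with hπ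
  have hsq : g ≫ π = (f ∣_ U) ≫ hU.isoSpec.hom := by
    rw [hg, hπ, hU.isoSpec_hom]; exact Scheme.Opens.toSpecΓ_naturality f U
  -- `g` is surjective
  haveI := QuasiCompact.compactSpace_of_compactSpace (f ∣_ U)
  haveI : IsDominant g := by
    rw [hg]; unfold Scheme.Opens.toSpecΓ
    exact MorphismProperty.RespectsIso.postcomp (P := @IsDominant) _ _ inferInstance
  haveI : UniversallyClosed (g ≫ π) := by rw [hsq]; infer_instance
  haveI : UniversallyClosed g := UniversallyClosed.of_comp_of_isSeparated g π
  have hgsurj : Function.Surjective g :=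
    (surjective_of_isDominant_of_isClosed_range g g.isClosedMap.isClosed_range).1
  -- compatibility: `f x ∈ fibre over s` iff `π (g x) = m`
  set pm : Spec Γ(S, U) := ⟨m, hm.isPrime⟩ with hpm
  have hcompat : ∀ x : ↥(f ⁻¹ᵁ U), f x.1 = hU.fromSpec pm ↔ π (g x) = pm := by
    intro x
    have e0 : π (g x) = hU.isoSpec.hom ((f ∣_ U) x) := by
      rw [← Scheme.Hom.comp_apply, hsq, Scheme.Hom.comp_apply]
    have e1 : f x.1 = hU.fromSpec (π (g x)) := by
      rw [e0, ← Scheme.Hom.comp_apply, hU.isoSpec_hom_fromSpec, Scheme.Opens.ι_apply,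
        morphismRestrict_base_coe]
    rw [e1]
    exact hU.fromSpec.isOpenEmbedding.injective.eq_iff
  -- the fibre inside `V`
  set F : Set ↥(f ⁻¹ᵁ U) := {x | π (g x) = pm} with hF
  have hFpre : _root_.IsPreconnected F := by
    have himg : ((f ⁻¹ᵁ U).ι : ↥(f ⁻¹ᵁ U) → X) '' F = f ⁻¹' {hU.fromSpec pm} := by
      ext y
      simp only [Set.mem_image, Set.mem_preimage, Set.mem_singleton_iff, hF,
        Scheme.Opens.ι_apply]
      constructor
      · rintro ⟨x, hx, rfl⟩; exact (hcompat x).mpr hx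
      · intro hy
        have hyV : y ∈ f ⁻¹ᵁ U := by
          change f y ∈ U
          rw [hy]
          have hr := Set.mem_range_self (f := fun p => hU.fromSpec p) pm
          rwa [hU.range_fromSpec] at hr
        exact ⟨⟨y, hyV⟩, (hcompat ⟨y, hyV⟩).mp hy, rfl⟩
    have h2 : _root_.IsPreconnected (((f ⁻¹ᵁ U).ι : ↥(f ⁻¹ᵁ U) → X) '' F) := by
      rw [himg]; exact hconn
    exact ((f ⁻¹ᵁ U).ι.isOpenEmbedding.isInducing.isPreconnected_image).mp h2
  -- the finitely many closed points of `Spec B` above `m`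
  set Max : Set (Spec Γ(X, f ⁻¹ᵁ U)) := π ⁻¹' {pm} with hMax
  have hMaxfin : Max.Finite := by
    haveI : IsFinite π := (IsFinite.SpecMap_iff _).mpr hfin
    exact π.finite_preimage_singleton pm
  letI := (f.app U).hom.toAlgebra
  haveI : Algebra.IsIntegral Γ(S, U) Γ(X, f ⁻¹ᵁ U) := ⟨hfin.to_isIntegral⟩
  have hclosed : ∀ q ∈ Max, IsClosed ({q} : Set (Spec Γ(X, f ⁻¹ᵁ U))) := by
    intro q hq
    have hq' : (q.asIdeal.comap (algebraMap Γ(S, U) Γ(X, f ⁻¹ᵁ U))).IsMaximal := by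
      have : (π q).asIdeal = m := congrArg PrimeSpectrum.asIdeal hq
      rw [RingHom.algebraMap_toAlgebra]
      change (π q).asIdeal.IsMaximal
      rw [this]; exact hm
    exact (PrimeSpectrum.isClosed_singleton_iff_isMaximal q).mpr
      (Ideal.isMaximal_of_isIntegral_of_isMaximal_comap q.asIdeal hq')
  -- the two points
  set q₁ : Spec Γ(X, f ⁻¹ᵁ U) := ⟨Q₁, hQ₁.isPrime⟩ with hq₁
  set q₂ : Spec Γ(X, f ⁻¹ᵁ U) := ⟨Q₂, hQ₂.isPrime⟩ with hq₂
  have hq₁M : q₁ ∈ Max := by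
    change π q₁ = pm; exact PrimeSpectrum.ext h₁
  have hq₂M : q₂ ∈ Max := by
    change π q₂ = pm; exact PrimeSpectrum.ext h₂
  by_contra hne
  have hne' : q₁ ≠ q₂ := fun h => hne (congrArg PrimeSpectrum.asIdeal h)
  -- the two closed pieces
  set u : Set ↥(f ⁻¹ᵁ U) := g ⁻¹' {q₁} with hu
  set v : Set ↥(f ⁻¹ᵁ U) := ⋃ q ∈ Max \ {q₁}, g ⁻¹' {q} with hv
  have hu_closed : IsClosed u := (hclosed q₁ hq₁M).preimage g.continuous
  have hv_closed : IsClosed v :=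
    (hMaxfin.sdiff).isClosed_biUnion fun q hq => (hclosed q hq.1).preimage g.continuous
  have hFuv : F ⊆ u ∪ v := by
    intro x hx
    by_cases hxq : g x = q₁
    · exact Or.inl hxq
    · refine Or.inr (Set.mem_biUnion (x := g x) ⟨hx, hxq⟩ rfl)
  have hdisj : F ∩ (u ∩ v) = ∅ := by
    ext x
    simp only [Set.mem_inter_iff, Set.mem_empty_iff_false, iff_false, not_and]
    intro _ hxu hxv
    rw [hv, Set.mem_iUnion₂] at hxv
    obtain ⟨q, hq, hxq⟩ := hxv
    exact hq.2 (hxq.symm.trans hxu)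
  obtain ⟨x₁, hx₁⟩ := hgsurj q₁
  obtain ⟨x₂, hx₂⟩ := hgsurj q₂
  have hx₁F : x₁ ∈ F := by change π (g x₁) = pm; rw [hx₁]; exact hq₁M
  have hx₂F : x₂ ∈ F := by change π (g x₂) = pm; rw [hx₂]; exact hq₂M
  rcases (isPreconnected_iff_subset_of_disjoint_closed.mp hFpre) u v hu_closed hv_closed hFuv hdisj
    with hFu | hFv
  · have : g x₂ = q₁ := hFu hx₂F
    exact hne' (this.symm.trans hx₂)
  · have hx₁v := hFv hx₁F
    rw [hv, Set.mem_iUnion₂] at hx₁v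
    obtain ⟨q, hq, hxq⟩ := hx₁v
    exact hq.2 (hxq.symm.trans hx₁ ▸ rfl)

/-- **`f_* 𝒪_X = 𝒪_S` from connected closed fibres (characteristic zero).** Let `k` be an
algebraically closed field of characteristic zero, `S` an integral normal `k`-scheme locally of
finite type, `f : X → S` a proper surjective morphism from an integral scheme, and suppose the
fibres of `f` over the closed points of `S` off a proper closed subset `T` are preconnected. Then
`𝒪_S(U) → 𝒪_X(f⁻¹U)` is bijective for every non-empty affine open `U ⊆ S`: it is injective (`f`
dominant, `S` reduced), finite (finiteness theorem) and `𝒪_S(U)` is an integrally closed domain of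
finite type over `k`, so `surjective_algebraMap_of_subsingleton_maximal_over` applies, its
hypothesis being `maximal_over_unique` at the closed points of `U ∖ T` off the zero set of a
function `c₀` vanishing on `T ∩ U`. -/
theorem bijective_app_of_isPreconnected_fibres {X S : Scheme.{u}} (f : X ⟶ S) [IsProper f]
    [IsIntegral X] [IsIntegral S] [Surjective f]
    {k : Type u} [Field k] [IsAlgClosed k] [CharZero k]
    (p : S ⟶ Spec (.of k)) [LocallyOfFiniteType p]
    (hS : ∀ s : S, IsIntegrallyClosed (S.presheaf.stalk s))
    {T : Set S} (hT : IsClosed T) (hTne : T ≠ Set.univ)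
    (hfib : ∀ s : S, IsClosed ({s} : Set S) → s ∉ T → _root_.IsPreconnected (f ⁻¹' {s}))
    (U : S.Opens) (hU : IsAffineOpen U) [hUne : Nonempty U] :
    Function.Bijective (f.app U) := by
  classical
  haveI : IsAffine U := hU
  haveI : IsLocallyNoetherian S := LocallyOfFiniteType.isLocallyNoetherian p
  haveI : JacobsonSpace S := LocallyOfFiniteType.jacobsonSpace p
  haveI : IsDomain Γ(X, f ⁻¹ᵁ U) := by
    obtain ⟨⟨y, hy⟩⟩ := hUne
    obtain ⟨x, rfl⟩ := f.surjective y
    exact @IsIntegral.component_integral X ‹_› (f ⁻¹ᵁ U) ⟨⟨x, hy⟩⟩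
  letI alg : Algebra Γ(S, U) Γ(X, f ⁻¹ᵁ U) := (f.app U).hom.toAlgebra
  have hinj : Function.Injective (f.app U) := by
    haveI : IsSchemeTheoreticallyDominant f := IsSchemeTheoreticallyDominant.of_isDominant f
    exact f.app_injective U
  haveI : FaithfulSMul Γ(S, U) Γ(X, f ⁻¹ᵁ U) :=
    (faithfulSMul_iff_algebraMap_injective _ _).mpr hinj
  haveI : IsIntegrallyClosed Γ(S, U) :=
    Literature.AlgebraicGeometry.Morphisms.TowardsNormal.isIntegrallyClosed_sections_of_stalk hU hS
  have hfin : (f.app U).hom.Finite := finite_app f U hU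
  haveI : Algebra.IsIntegral Γ(S, U) Γ(X, f ⁻¹ᵁ U) := ⟨hfin.to_isIntegral⟩
  -- `𝒪_S(U)` is of finite type over `k`
  let i : k →+* Γ(S, U) := (p.appLE ⊤ U le_top).hom.comp (Scheme.ΓSpecIso (.of k)).inv.hom
  letI algk : Algebra k Γ(S, U) := i.toAlgebra
  haveI : Algebra.FiniteType k Γ(S, U) := by
    have h1 : (p.appLE ⊤ U le_top).hom.FiniteType :=
      HasRingHomProperty.appLE @LocallyOfFiniteType p inferInstance ⟨⊤, isAffineOpen_top _⟩
        ⟨U, hU⟩ le_top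
    have h2 : i.FiniteType := h1.comp (RingHom.FiniteType.of_surjective _
      (ConcreteCategory.bijective_of_isIso (Scheme.ΓSpecIso (.of k)).inv).2)
    exact h2
  -- a non-zero function `c₀` on `U` whose non-vanishing locus misses `T`
  let W : S.Opens := U ⊓ ⟨Tᶜ, hT.isOpen_compl⟩
  have hξU : genericPoint S ∈ U :=
    Literature.AlgebraicGeometry.Morphisms.TowardsNormal.genericPoint_mem S U
  have hξT : genericPoint S ∉ T := by
    intro h
    apply hTne
    have h1 : closure ({genericPoint S} : Set S) ⊆ T := hT.closure_subset_iff.mpr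
      (Set.singleton_subset_iff.mpr h)
    rw [genericPoint_closure] at h1
    exact Set.eq_univ_of_univ_subset h1
  obtain ⟨c₀, hc₀W, hc₀mem⟩ :=
    hU.exists_basicOpen_le (V := W) ⟨genericPoint S, ⟨hξU, hξT⟩⟩ hξU
  have hc₀ : c₀ ≠ 0 := by
    rintro rfl
    rw [Scheme.basicOpen_zero] at hc₀mem
    exact hc₀mem
  -- hypothesis (H) of the algebraic lemma, from `maximal_over_unique`
  have H : ∀ m : Ideal Γ(S, U), m.IsMaximal → c₀ ∉ m → ∀ Q₁ Q₂ : Ideal Γ(X, f ⁻¹ᵁ U),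
      Q₁.IsMaximal → Q₂.IsMaximal → Q₁.comap (algebraMap _ _) = m →
      Q₂.comap (algebraMap _ _) = m → Q₁ = Q₂ := by
    intro m hm hcm Q₁ Q₂ hQ₁ hQ₂ e₁ e₂
    refine maximal_over_unique f U hU hfin m ?_ Q₁ Q₂ e₁ e₂
    set pm : Spec Γ(S, U) := ⟨m, hm.isPrime⟩ with hpm
    apply hfib
    · have hpmc : IsClosed ({pm} : Set (Spec Γ(S, U))) :=
        (PrimeSpectrum.isClosed_singleton_iff_isMaximal pm).mpr hm
      have hmem : pm ∈ (fun q => hU.fromSpec q) ⁻¹' closedPoints S := by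
        rw [hU.fromSpec.isOpenEmbedding.preimage_closedPoints]; exact hpmc
      exact hmem
    · have h1 : hU.fromSpec pm ∈ S.basicOpen c₀ := by
        have : pm ∈ hU.fromSpec ⁻¹ᵁ S.basicOpen c₀ := by
          rw [hU.fromSpec_preimage_basicOpen]; exact hcm
        exact this
      exact (hc₀W h1).2
  exact ⟨hinj, surjective_algebraMap_of_subsingleton_maximal_over (k := k) hc₀ H⟩

/-- **The Stein factorisation is trivial**: under the hypotheses of
`bijective_app_of_isPreconnected_fibres`, `S` is integrally closed in `f_* 𝒪_X` — indeed
`𝒪_S = f_* 𝒪_X` on affine opens — so the integral part `S' → S` of the Stein factorisation of `f`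
(Mathlib's `f.fromNormalization`) is an isomorphism (Zariski-locally on `S`, as in
`Literature.AlgebraicGeometry.Morphisms.TowardsNormal.isIso_fromNormalization`). -/
theorem isIso_fromNormalization_of_isPreconnected_fibres {X S : Scheme.{u}} (f : X ⟶ S)
    [IsProper f] [IsIntegral X] [IsIntegral S] [Surjective f]
    {k : Type u} [Field k] [IsAlgClosed k] [CharZero k]
    (p : S ⟶ Spec (.of k)) [LocallyOfFiniteType p]
    (hS : ∀ s : S, IsIntegrallyClosed (S.presheaf.stalk s))
    {T : Set S} (hT : IsClosed T) (hTne : T ≠ Set.univ)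
    (hfib : ∀ s : S, IsClosed ({s} : Set S) → s ∉ T → _root_.IsPreconnected (f ⁻¹' {s})) :
    IsIso f.fromNormalization := by
  apply IsZariskiLocalAtTarget.of_forall_exists_morphismRestrict
    (P := MorphismProperty.isomorphisms Scheme)
  intro x
  obtain ⟨_, ⟨U, hU, rfl⟩, hxU, -⟩ :=
    S.isBasis_affineOpens.exists_subset_of_mem_open (Set.mem_univ x) isOpen_univ
  refine ⟨U, hxU, ?_⟩
  show IsIso (f.fromNormalization ∣_ U)
  haveI : Nonempty U := ⟨⟨x, hxU⟩⟩
  rw [isIso_morphismRestrict_iff_isIso_app _ hU, f.fromNormalization_app hU]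
  letI := (f.app U).hom.toAlgebra
  have hb := bijective_app_of_isPreconnected_fibres f p hS hT hTne hfib U hU
  have hbij : Function.Bijective
      (algebraMap Γ(S, U) (integralClosure Γ(S, U) Γ(X, f ⁻¹ᵁ U))) := by
    refine ⟨fun a b e ↦ hb.1 (congrArg Subtype.val e), fun b ↦ ?_⟩
    obtain ⟨a, ha⟩ := hb.2 b.1
    exact ⟨a, Subtype.ext ha⟩
  haveI : IsIso (CommRingCat.ofHom
      (algebraMap Γ(S, U) (integralClosure Γ(S, U) Γ(X, f ⁻¹ᵁ U)))) :=
    (ConcreteCategory.isIso_iff_bijective _).mpr hbij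
  infer_instance

/-- **All fibres are geometrically connected** (Zariski's connectedness theorem, through the
tree's proof of Stein factorisation `steinFactorization_geometricallyConnected_holds`): under the
hypotheses of `bijective_app_of_isPreconnected_fibres` — `S` integral, normal, locally of finite
type over an algebraically closed field of characteristic zero, `f : X → S` proper surjective with
`X` integral, and preconnected fibres over the closed points off a proper closed `T ⊆ S` — the
morphism `f` has geometrically connected fibres over EVERY point of `S`. -/
theorem geometricallyConnected_of_isPreconnected_fibres {X S : Scheme.{u}} (f : X ⟶ S)
    [IsProper f] [IsIntegral X] [IsIntegral S] [Surjective f]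
    {k : Type u} [Field k] [IsAlgClosed k] [CharZero k]
    (p : S ⟶ Spec (.of k)) [LocallyOfFiniteType p]
    (hS : ∀ s : S, IsIntegrallyClosed (S.presheaf.stalk s))
    {T : Set S} (hT : IsClosed T) (hTne : T ≠ Set.univ)
    (hfib : ∀ s : S, IsClosed ({s} : Set S) → s ∉ T → _root_.IsPreconnected (f ⁻¹' {s})) :
    GeometricallyConnected f := by
  haveI := isIso_fromNormalization_of_isPreconnected_fibres f p hS hT hTne hfib
  exact Literature.AlgebraicGeometry.Morphisms.steinFactorization_geometricallyConnected_holds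
    |>.of_isIso_fromNormalization f

end LevelZeroNetsStein

end Summit.HodgeConjecture.HodgeConjecture.Theorems

end
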